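import Literature.AnabelianGeometry.SemiGraphs.CoverticialAssembly
import Literature.AnabelianGeometry.SemiGraphs.CoverticialEdgeDescent
import HarnessLib

/-!
# [SemiAnbd] Proposition 2.6 (Commensurability) and Corollary 2.7 (iii) — discharged

Mochizuki, *Semi-graphs of anabelioids*, Publ. RIMS **42** (2006), Proposition 2.6, author's
manuscript pp. 28–29 [cite: MochizukiSemiAnbd2006, Prop. 2.6 pp.28-29]: abc-iut-L3-t1's named fact
`proposition_2_6` (`Coverticial.lean`) holds.  Assembly (`CoverticialAssembly.lean`,
`proposition_2_6_of_edgeCase`) of the elevated-vertex case (`CoverticialVertexCase.lean`) and the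
sub-coverticial-edge case (`CoverticialEdgeDescent.lean`, which consumes only the LOCAL conjunct
`Hom.IsFiniteEtaleCoveringOf` of the covering exhibiting the coverticial pair).  With abc-iut-L3-t1's
`corollary_2_7_iii_of_proposition_2_6` (`CoverticialProofs.lean`, "a formal consequence of
Proposition 2.6", p. 30) the named fact `corollary_2_7_iii` follows.  Proof-only (abc-iut-L6-t18,
sub-node P26-R).  Nothing here takes a side on [IUTchIII] Cor. 3.12.
-/

namespace Literature.AnabelianGeometry.SemiGraphs

open CategoryTheory CategoryTheory.PreGaloisCategory
open scoped Pointwise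

universe v₁ u₁ u

namespace SemiGraphOfAnabelioids

/-- **[SemiAnbd] Proposition 2.6 (Commensurability)** holds as typed: for a connected quasi-coherent
graph of anabelioids `𝒢`, connected subgraphs `ℍ`, `𝕂` and a constituent of `ℍ ∖ 𝕂` which is an
elevated vertex or a sub-coverticial edge, `Π_ℍ ∩ g Π_𝕂 g⁻¹` has infinite index in `Π_ℍ` for every
`g ∈ Π_𝒢`; in particular no conjugate of `Π_ℍ` is commensurable to a conjugate of `Π_𝕂`.
[cite: MochizukiSemiAnbd2006, Prop. 2.6 pp.28-29] -/
theorem proposition_2_6_holds : proposition_2_6.{v₁, u₁, u} :=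
  proposition_2_6_of_edgeCase
    fun 𝒢 _ _ _ H K hH _ hHg _ e heH heK he w F _ w' F' _ α g => by
      obtain ⟨-, 𝒢', φ, ⟨A, hloc, -, -, -⟩, e₁, e₂, hne, hcov, he₁, he₂⟩ := he
      exact 𝒢.relIndex_conj_piK_piH_eq_zero_of_isFiniteEtaleCoveringOf φ A hloc hne hcov he₁ he₂
        H K hH hHg heH heK w F w' F' α g

/-- **[SemiAnbd] Corollary 2.7 (iii)** holds as typed ("a formal consequence of Proposition 2.6",
proof of Cor. 2.7, last line, p. 30): connected subgraphs `ℍ`, `𝕂` all of whose constituents are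
elevated vertices / sub-coverticial edges and whose groups `Π_ℍ`, `Π_𝕂` have commensurable conjugates
coincide. [cite: MochizukiSemiAnbd2006, Cor. 2.7(iii) p.30] -/
theorem corollary_2_7_iii_holds : corollary_2_7_iii.{v₁, u₁, u} :=
  corollary_2_7_iii_of_proposition_2_6 proposition_2_6_holds

end SemiGraphOfAnabelioids

end Literature.AnabelianGeometry.SemiGraphs
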